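import Mathlib
import HarnessLib

/-!
# Convergent matrices: `Aᵏ → 0 ⇔ ρ(A) < 1`; Neumann series (Horn–Johnson 5.6.12, 5.6.15–16)

Topic `Literature/LinearAlgebra/Matrix`; support file (everything PROVED; no definitions; no named
facts).

Horn–Johnson, *Matrix Analysis* (2nd ed.), §5.6: **Thm. 5.6.12** — for `A ∈ Mₙ`,
`lim_{k→∞} Aᵏ = 0` (each entry of `Aᵏ` tends to zero) if and only if `ρ(A) < 1`; Cor. 5.6.13 —
`|(Aᵏ)ᵢⱼ| ≤ C (ρ(A)+ε)ᵏ`; **Thm. 5.6.15** (with `aₖ = 1`, `R = 1`) — `Σ Aᵏ` converges if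
`ρ(A) < 1`; **Cor. 5.6.16** and the exercise following it — then `I − A` is nonsingular and
`(I − A)⁻¹ = Σ_{k≥0} Aᵏ`.

Typed from Gelfand's formula (Mathlib
`spectrum.pow_nnnorm_pow_one_div_tendsto_nhds_spectralRadius`, = HJ Cor. 5.6.14) instead of the
book's Lemma 5.6.10 (a matrix norm with `‖A‖ < ρ(A) + ε`), first for an element `a` of any complex
Banach algebra, then for complex matrices in the entrywise form of the
book (the matrix statements mention no norm: `spectralRadius` is algebraic and the limits are taken
entry by entry):
* `eventually_nnnorm_pow_le_of_spectralRadius_lt` — `ρ(a) < r ⇒ ‖aᵏ‖ ≤ rᵏ` for all large `k`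
  (the quantitative half of Cor. 5.6.13);
* `tendsto_pow_of_spectralRadius_lt_one` / `spectralRadius_lt_one_of_tendsto_pow` /
  `tendsto_pow_atTop_nhds_zero_iff` — Thm. 5.6.12 in a Banach algebra (`⇐` needs `‖1‖ = 1`);
* `summable_pow_of_spectralRadius_lt_one`, `tsum_pow_mul_one_sub`, `one_sub_mul_tsum_pow`,
  `isUnit_one_sub_of_spectralRadius_lt_one`, `inverse_one_sub_eq_tsum_pow` — Thm. 5.6.15 /
  Cor. 5.6.16: the Neumann series `Σ aᵏ` converges and is the two-sided inverse of `1 − a`;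
* `tendsto_pow_apply_iff_spectralRadius_lt_one` — **Thm. 5.6.12 verbatim** for
  `A : Matrix n n ℂ`: `(∀ i j, (Aᵏ)ᵢⱼ → 0) ↔ spectralRadius ℂ A < 1` (`n` nonempty; the direction
  `⇐`, `tendsto_pow_apply_of_spectralRadius_lt_one`, for any `n`);
* `eventually_norm_pow_apply_le` — Cor. 5.6.13 (`‖(Aᵏ)ᵢⱼ‖ ≤ rᵏ` eventually, any
  `r > ρ(A)`);
* `matrix_isUnit_one_sub_of_spectralRadius_lt_one`, `hasSum_pow_apply_inv_one_sub` —
  Cor. 5.6.16: `I − A` is invertible and `((I − A)⁻¹)ᵢⱼ = Σₖ (Aᵏ)ᵢⱼ` entrywise.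

References:
* R. A. Horn, C. R. Johnson, *Matrix Analysis*, 2nd ed., Cambridge University Press 2013, §5.6:
  Lemma 5.6.11, Thm. 5.6.12, Cor. 5.6.13, Cor. 5.6.14 (Gelfand), Thm. 5.6.15, Cor. 5.6.16 and the
  exercise following it. Held copy `book:horn2012-matrix-analysis`, PDF pp. 439–442.
  [HornJohnson2013]
-/

namespace Literature.LinearAlgebra.Matrix

open scoped _root_.ENNReal _root_.NNReal _root_.Topology
open Filter Finset

section BanachAlgebra

variable {A : Type*} [NormedRing A] [NormedAlgebra ℂ A] [CompleteSpace A]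

/-- **Quantitative Gelfand bound** (the estimate inside HJ Cor. 5.6.13 / Cor. 5.6.14): if
`ρ(a) < r` then `‖aᵏ‖ ≤ rᵏ` for all sufficiently large `k`.
[cite: HornJohnson2013, Cor. 5.6.13 and Cor. 5.6.14] -/
theorem eventually_nnnorm_pow_le_of_spectralRadius_lt {a : A} {r : ℝ≥0}
    (h : spectralRadius ℂ a < r) : ∀ᶠ k in atTop, ‖a ^ k‖₊ ≤ r ^ k := by
  have hlt := (spectrum.pow_nnnorm_pow_one_div_tendsto_nhds_spectralRadius a).eventually_lt_const h
  filter_upwards [hlt, eventually_ne_atTop 0] with k hk hk0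
  have hkpos : (0 : ℝ) < k := Nat.cast_pos.2 (Nat.pos_of_ne_zero hk0)
  -- raise `‖aᵏ‖^(1/k) < r` to the `k`-th power
  have hpow : ((‖a ^ k‖₊ : ℝ≥0∞) ^ (1 / (k : ℝ))) ^ (k : ℝ) ≤ ((r : ℝ≥0∞)) ^ (k : ℝ) :=
    ENNReal.rpow_le_rpow hk.le hkpos.le
  rw [← ENNReal.rpow_mul, one_div_mul_cancel hkpos.ne', ENNReal.rpow_one, ENNReal.rpow_natCast,
    ← ENNReal.coe_pow, ENNReal.coe_le_coe] at hpow
  exact hpow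

/-- **HJ Thm. 5.6.12 (⇐), Banach-algebra form**: `ρ(a) < 1 ⇒ aᵏ → 0`.
[cite: HornJohnson2013, Thm. 5.6.12] -/
theorem tendsto_pow_of_spectralRadius_lt_one {a : A} (h : spectralRadius ℂ a < 1) :
    Tendsto (fun k : ℕ => a ^ k) atTop (𝓝 0) := by
  obtain ⟨r, hr, hr1⟩ := ENNReal.lt_iff_exists_nnreal_btwn.1 h
  have hr1' : (r : ℝ) < 1 := by exact_mod_cast (ENNReal.coe_lt_one_iff.1 hr1)
  refine squeeze_zero_norm' ?_ (tendsto_pow_atTop_nhds_zero_of_lt_one r.coe_nonneg hr1')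
  filter_upwards [eventually_nnnorm_pow_le_of_spectralRadius_lt hr] with k hk
  exact_mod_cast hk

/-- **HJ Thm. 5.6.12 (⇒), Banach-algebra form** (with `‖1‖ = 1`): `aᵏ → 0 ⇒ ρ(a) < 1`, since
`ρ(a) ≤ ‖aᵏ‖^{1/k}` for every `k ≥ 1`. [cite: HornJohnson2013, Thm. 5.6.12] -/
theorem spectralRadius_lt_one_of_tendsto_pow [NormOneClass A] {a : A}
    (h : Tendsto (fun k : ℕ => a ^ k) atTop (𝓝 0)) : spectralRadius ℂ a < 1 := by
  have h' : Tendsto (fun k : ℕ => ‖a ^ (k + 1)‖) atTop (𝓝 0) :=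
    (tendsto_zero_iff_norm_tendsto_zero.1 h).comp (tendsto_add_atTop_nat 1)
  obtain ⟨N, hN⟩ := (h'.eventually (gt_mem_nhds one_pos)).exists
  have hN' : (‖a ^ (N + 1)‖₊ : ℝ≥0∞) < 1 := by
    have : ‖a ^ (N + 1)‖₊ < 1 := by exact_mod_cast hN
    exact_mod_cast ENNReal.coe_lt_one_iff.2 this
  calc spectralRadius ℂ a
      ≤ (‖a ^ (N + 1)‖₊ : ℝ≥0∞) ^ (1 / (N + 1) : ℝ) * (‖(1 : A)‖₊ : ℝ≥0∞) ^ (1 / (N + 1) : ℝ) :=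
        spectrum.spectralRadius_le_pow_nnnorm_pow_one_div ℂ a N
    _ = (‖a ^ (N + 1)‖₊ : ℝ≥0∞) ^ (1 / (N + 1) : ℝ) := by simp
    _ < 1 := ENNReal.rpow_lt_one hN' (by positivity)

/-- **HJ Thm. 5.6.12, Banach-algebra form**: `aᵏ → 0 ⇔ ρ(a) < 1` (complex Banach algebra with
`‖1‖ = 1`). [cite: HornJohnson2013, Thm. 5.6.12] -/
theorem tendsto_pow_atTop_nhds_zero_iff [NormOneClass A] (a : A) :
    Tendsto (fun k : ℕ => a ^ k) atTop (𝓝 0) ↔ spectralRadius ℂ a < 1 :=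
  ⟨spectralRadius_lt_one_of_tendsto_pow, tendsto_pow_of_spectralRadius_lt_one⟩

/-- **HJ Thm. 5.6.15 (geometric series)**: `ρ(a) < 1 ⇒ Σₖ aᵏ` converges (absolutely, by comparison
with `Σ rᵏ`, `ρ(a) < r < 1`). [cite: HornJohnson2013, Thm. 5.6.15] -/
theorem summable_pow_of_spectralRadius_lt_one {a : A} (h : spectralRadius ℂ a < 1) :
    Summable fun k : ℕ => a ^ k := by
  obtain ⟨r, hr, hr1⟩ := ENNReal.lt_iff_exists_nnreal_btwn.1 h
  have hr1' : (r : ℝ) < 1 := by exact_mod_cast (ENNReal.coe_lt_one_iff.1 hr1)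
  refine Summable.of_norm_bounded_eventually (g := fun k : ℕ => (r : ℝ) ^ k)
    (summable_geometric_of_lt_one r.coe_nonneg hr1') ?_
  rw [Nat.cofinite_eq_atTop]
  filter_upwards [eventually_nnnorm_pow_le_of_spectralRadius_lt hr] with k hk
  exact_mod_cast hk

/-- **HJ Cor. 5.6.16 (Neumann series, right inverse)**: `ρ(a) < 1 ⇒ (Σₖ aᵏ)(1 − a) = 1`.
[cite: HornJohnson2013, Cor. 5.6.16] -/
theorem tsum_pow_mul_one_sub {a : A} (h : spectralRadius ℂ a < 1) :
    (∑' k : ℕ, a ^ k) * (1 - a) = 1 := by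
  have hs := (summable_pow_of_spectralRadius_lt_one h).hasSum.tendsto_sum_nat
  have h1 : Tendsto (fun N : ℕ => (∑ k ∈ range N, a ^ k) * (1 - a)) atTop
      (𝓝 ((∑' k : ℕ, a ^ k) * (1 - a))) := hs.mul tendsto_const_nhds
  have h2 : Tendsto (fun N : ℕ => (∑ k ∈ range N, a ^ k) * (1 - a)) atTop (𝓝 (1 - 0)) := by
    simp_rw [geom_sum_mul_neg]
    exact tendsto_const_nhds.sub (tendsto_pow_of_spectralRadius_lt_one h)
  rw [sub_zero] at h2
  exact tendsto_nhds_unique h1 h2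

/-- **HJ Cor. 5.6.16 (Neumann series, left inverse)**: `ρ(a) < 1 ⇒ (1 − a)(Σₖ aᵏ) = 1`.
[cite: HornJohnson2013, Cor. 5.6.16] -/
theorem one_sub_mul_tsum_pow {a : A} (h : spectralRadius ℂ a < 1) :
    (1 - a) * (∑' k : ℕ, a ^ k) = 1 := by
  have hs := (summable_pow_of_spectralRadius_lt_one h).hasSum.tendsto_sum_nat
  have h1 : Tendsto (fun N : ℕ => (1 - a) * ∑ k ∈ range N, a ^ k) atTop
      (𝓝 ((1 - a) * ∑' k : ℕ, a ^ k)) := tendsto_const_nhds.mul hs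
  have h2 : Tendsto (fun N : ℕ => (1 - a) * ∑ k ∈ range N, a ^ k) atTop (𝓝 (1 - 0)) := by
    simp_rw [mul_neg_geom_sum]
    exact tendsto_const_nhds.sub (tendsto_pow_of_spectralRadius_lt_one h)
  rw [sub_zero] at h2
  exact tendsto_nhds_unique h1 h2

/-- **HJ Cor. 5.6.16**: `ρ(a) < 1 ⇒ 1 − a` is invertible (its inverse being the Neumann series).
[cite: HornJohnson2013, Cor. 5.6.16] -/
theorem isUnit_one_sub_of_spectralRadius_lt_one {a : A} (h : spectralRadius ℂ a < 1) :
    IsUnit (1 - a) :=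
  ⟨⟨1 - a, ∑' k : ℕ, a ^ k, one_sub_mul_tsum_pow h, tsum_pow_mul_one_sub h⟩, rfl⟩

/-- **HJ Cor. 5.6.16**: `ρ(a) < 1 ⇒ (1 − a)⁻¹ = Σₖ aᵏ` (`Ring.inverse`).
[cite: HornJohnson2013, Cor. 5.6.16] -/
theorem inverse_one_sub_eq_tsum_pow {a : A} (h : spectralRadius ℂ a < 1) :
    Ring.inverse (1 - a) = ∑' k : ℕ, a ^ k := by
  rw [← (isUnit_one_sub_of_spectralRadius_lt_one h).unit_spec, Ring.inverse_unit]
  exact Units.inv_eq_of_mul_eq_one_right (by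
    rw [(isUnit_one_sub_of_spectralRadius_lt_one h).unit_spec]; exact one_sub_mul_tsum_pow h)

end BanachAlgebra

section Matrices

open _root_.Matrix

variable {n : Type*} [Fintype n] [DecidableEq n]

attribute [local instance] Matrix.linftyOpNormedRing Matrix.linftyOpNormedAlgebra

/-- Entries are bounded by the `ℓ∞`-operator norm `‖M‖ = maxᵢ Σⱼ ‖mᵢⱼ‖`. [folklore] -/
private theorem nnnorm_apply_le_linfty_opNNNorm (M : Matrix n n ℂ) (i j : n) : ‖M i j‖₊ ≤ ‖M‖₊ := by
  rw [Matrix.linfty_opNNNorm_def]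
  exact (Finset.single_le_sum (f := fun l => ‖M i l‖₊) (fun _ _ => zero_le) (mem_univ j)).trans
    (Finset.le_sup (f := fun k => ∑ l, ‖M k l‖₊) (mem_univ i))

/-- The `ℓ∞`-operator norm is bounded by the sum of all entries. [folklore] -/
private theorem linfty_opNNNorm_le_sum (M : Matrix n n ℂ) : ‖M‖₊ ≤ ∑ i, ∑ j, ‖M i j‖₊ := by
  rw [Matrix.linfty_opNNNorm_def]
  exact Finset.sup_le fun i _ =>
    Finset.single_le_sum (f := fun k => ∑ l, ‖M k l‖₊) (fun _ _ => zero_le) (mem_univ i)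

/-- Norm convergence of matrices gives entrywise convergence (stated on the norms, so that no
topology on matrices is mentioned). [folklore] -/
private theorem tendsto_apply_of_norm_tendsto {ι : Type*} {l : Filter ι} {F : ι → Matrix n n ℂ}
    {M : Matrix n n ℂ} (h : Tendsto (fun x => ‖F x - M‖) l (𝓝 0)) (i j : n) :
    Tendsto (fun x => F x i j) l (𝓝 (M i j)) := by
  rw [tendsto_iff_norm_sub_tendsto_zero]
  refine squeeze_zero (fun _ => norm_nonneg _) (fun x => ?_) h
  rw [← Matrix.sub_apply]
  exact_mod_cast nnnorm_apply_le_linfty_opNNNorm (F x - M) i j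

/-- Entrywise convergence of matrices gives norm convergence (finitely many entries). [folklore] -/
private theorem norm_tendsto_of_tendsto_apply {ι : Type*} {l : Filter ι} {F : ι → Matrix n n ℂ}
    {M : Matrix n n ℂ} (h : ∀ i j, Tendsto (fun x => F x i j) l (𝓝 (M i j))) :
    Tendsto (fun x => ‖F x - M‖) l (𝓝 0) := by
  have hsum : Tendsto (fun x => ∑ i, ∑ j, ‖(F x - M) i j‖) l (𝓝 (∑ i : n, ∑ j : n, (0 : ℝ))) := by
    refine tendsto_finsetSum _ fun i _ => tendsto_finsetSum _ fun j _ => ?_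
    have := (tendsto_iff_norm_sub_tendsto_zero.1 (h i j))
    simpa only [Matrix.sub_apply] using this
  simp only [sum_const_zero] at hsum
  refine squeeze_zero (fun _ => norm_nonneg _) (fun x => ?_) hsum
  simpa only [coe_nnnorm, NNReal.coe_sum] using
    NNReal.coe_le_coe.2 (linfty_opNNNorm_le_sum (F x - M))

/-- **HJ Thm. 5.6.12 (⇐)**, no `Nonempty` hypothesis: `ρ(A) < 1 ⇒ (Aᵏ)ᵢⱼ → 0` for all `i, j`.
[cite: HornJohnson2013, Thm. 5.6.12] -/
theorem tendsto_pow_apply_of_spectralRadius_lt_one {A : Matrix n n ℂ} (h : spectralRadius ℂ A < 1)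
    (i j : n) : Tendsto (fun k : ℕ => (A ^ k) i j) atTop (𝓝 0) := by
  have h0 := tendsto_iff_norm_sub_tendsto_zero.1 (tendsto_pow_of_spectralRadius_lt_one h)
  simpa using tendsto_apply_of_norm_tendsto h0 i j

/-- **Horn–Johnson Thm. 5.6.12** for complex matrices, verbatim: each entry of `Aᵏ` tends to zero
as `k → ∞` if and only if `ρ(A) < 1` (`spectralRadius` over `ℂ` in the matrix algebra; no norm is
mentioned in the statement). [cite: HornJohnson2013, Thm. 5.6.12] -/
theorem tendsto_pow_apply_iff_spectralRadius_lt_one [Nonempty n] (A : Matrix n n ℂ) :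
    (∀ i j, Tendsto (fun k : ℕ => (A ^ k) i j) atTop (𝓝 0)) ↔ spectralRadius ℂ A < 1 := by
  constructor
  · intro h
    refine spectralRadius_lt_one_of_tendsto_pow (tendsto_iff_norm_sub_tendsto_zero.2 ?_)
    exact norm_tendsto_of_tendsto_apply fun i j => by simpa using h i j
  · intro h i j
    exact tendsto_pow_apply_of_spectralRadius_lt_one h i j

/-- **HJ Cor. 5.6.13 (quantitative form)**: if `ρ(A) < r` then `‖(Aᵏ)ᵢⱼ‖ ≤ rᵏ` for all large `k`
and all `i, j`. [cite: HornJohnson2013, Cor. 5.6.13] -/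
theorem eventually_norm_pow_apply_le {A : Matrix n n ℂ} {r : ℝ≥0}
    (h : spectralRadius ℂ A < r) (i j : n) : ∀ᶠ k in atTop, ‖(A ^ k) i j‖ ≤ (r : ℝ) ^ k := by
  filter_upwards [eventually_nnnorm_pow_le_of_spectralRadius_lt h] with k hk
  exact_mod_cast (nnnorm_apply_le_linfty_opNNNorm (A ^ k) i j).trans hk

/-- **HJ Cor. 5.6.16 for matrices**: `ρ(A) < 1 ⇒ I − A` is invertible (`IsUnit`, equivalently
`det (I − A) ≠ 0`). [cite: HornJohnson2013, Cor. 5.6.16] -/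
theorem matrix_isUnit_one_sub_of_spectralRadius_lt_one {A : Matrix n n ℂ}
    (h : spectralRadius ℂ A < 1) : IsUnit (1 - A) :=
  isUnit_one_sub_of_spectralRadius_lt_one h

/-- **HJ Cor. 5.6.16 for matrices, Neumann series entrywise**: `ρ(A) < 1 ⇒` for all `i, j`,
`Σₖ (Aᵏ)ᵢⱼ` converges to `((I − A)⁻¹)ᵢⱼ` (`⁻¹` = `Matrix.inv`).
[cite: HornJohnson2013, Thm. 5.6.15 and Cor. 5.6.16] -/
theorem hasSum_pow_apply_inv_one_sub {A : Matrix n n ℂ} (h : spectralRadius ℂ A < 1)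
    (i j : n) : HasSum (fun k : ℕ => (A ^ k) i j) ((1 - A)⁻¹ i j) := by
  -- the entry series is absolutely convergent (`‖(Aᵏ)ᵢⱼ‖ ≤ rᵏ` eventually, `ρ(A) < r < 1`)
  obtain ⟨r, hr, hr1⟩ := ENNReal.lt_iff_exists_nnreal_btwn.1 h
  have hr1' : (r : ℝ) < 1 := by exact_mod_cast (ENNReal.coe_lt_one_iff.1 hr1)
  have hsf : Summable (fun k : ℕ => (A ^ k) i j) := by
    refine Summable.of_norm_bounded_eventually (g := fun k : ℕ => (r : ℝ) ^ k)
      (summable_geometric_of_lt_one r.coe_nonneg hr1') ?_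
    rw [Nat.cofinite_eq_atTop]
    exact eventually_norm_pow_apply_le hr i j
  rw [hsf.hasSum_iff_tendsto_nat]
  -- partial sums, natively in the matrix ring: `Σ_{k<N} Aᵏ = (I − A)⁻¹ (I − Aᴺ)`
  have hdet : IsUnit (1 - A).det :=
    (Matrix.isUnit_iff_isUnit_det _).1 (isUnit_one_sub_of_spectralRadius_lt_one h)
  have hP : ∀ N : ℕ, ∑ k ∈ range N, A ^ k = (1 - A)⁻¹ * (1 - A ^ N) := fun N => by
    rw [← mul_neg_geom_sum, ← mul_assoc, Matrix.nonsing_inv_mul _ hdet, one_mul]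
  have hentry : ∀ N : ℕ, ∑ k ∈ range N, (A ^ k) i j
      = (1 - A)⁻¹ i j - ∑ l, (1 - A)⁻¹ i l * (A ^ N) l j := fun N => by
    have e := congrFun (congrFun (hP N) i) j
    rw [Matrix.sum_apply, mul_sub, mul_one, Matrix.sub_apply, Matrix.mul_apply] at e
    exact e
  simp_rw [hentry]
  -- and `(Aᴺ)ₗⱼ → 0` entrywise (Thm. 5.6.12 ⇐), so the finite sum tends to `0`
  have h0 : Tendsto (fun N : ℕ => ∑ l, (1 - A)⁻¹ i l * (A ^ N) l j) atTop
      (𝓝 (∑ l : n, (1 - A)⁻¹ i l * 0)) :=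
    tendsto_finsetSum _ fun l _ => (tendsto_pow_apply_of_spectralRadius_lt_one h l j).const_mul _
  simp only [mul_zero, sum_const_zero] at h0
  simpa using tendsto_const_nhds.sub h0

end Matrices

end Literature.LinearAlgebra.Matrix
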